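import Mathlib
import Summits.NavierStokesRegularity.NavierStokesRegularity.Theorems.L3TimeExponentPincerJawEnergyFloor
import Summits.NavierStokesRegularity.NavierStokesRegularity.Theorems.L3TimeExponentPincerRingPersistenceHolds
import Literature.Analysis.FluidPDE.DissipationWavenumber
import Literature.Analysis.FluidPDE.WholeSpaceIBP
import Literature.Analysis.FunctionSpaces.SobolevDomainProofs
import HarnessLib.Audit
import HarnessLib

/-!
# L3TimeExponentPincer — the uniform quantitative jaw holds EXACTLY on and below the energy line:
# `QuantJaw q ↔ q ≤ 4`

Support kernel for the crux `L3CascadeJaw` (item stmt-NavierStokesRegularity-19499).  Combines the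
two halves now in the tree:

* BELOW/ON the energy line (`q ≤ 4`) the uniform bound holds with an explicit constant:
  `lpTime_three_four_le` — `∫₀ᵀ ‖u‖₃⁴ ≤ E₀ · K² · E(u₀)/ν` for every frame solution
  (`E₀ = ∫|u₀|²`, `E(u₀) = E₀/2`, `K` the Gagliardo–Nirenberg–Sobolev constant of `ℝ³`): the slice
  inequality `‖u‖₃⁴ ≤ ‖u‖₂² K² ∫|∇u|²` (`…JawEnergyFloor.eLpNorm_three_rpow_four_le`), the
  Leray–Hopf energy bound, and the DISSIPATION BOUND `∫₀ᵀ∫|∇u|² ≤ E(u₀)/ν` of the energy inequality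
  (`IsLerayHopfOn.exists_measurable_dissipation`, the classical gradient identified with the weak one
  slice-wise by `HasWeakFDerivOn.unique`); hence `quantJaw_four : QuantJaw 4` and, by
  `x^q ≤ 1 + x⁴`, `quantJaw_of_le_four : 0 ≤ q ≤ 4 → QuantJaw q`;
* ABOVE the energy line the rings kill it: `not_quantJaw` (`…RingPersistenceHolds`, `q > 4`).

* `quantJaw_iff : 0 ≤ q → (QuantJaw q ↔ q ≤ 4)` — the dichotomy of ROUND-11 («the jaw has no
  constant above the energy line, and the energy line is its exact floor») as one kernel theorem.

WHAT THIS IS NOT: not NS regularity or blow-up; the crux `L3CascadeJaw` (finiteness of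
`∫‖u‖₃^q` for BLOW-UP solutions, `4 < q < 5`, no uniformity) is untouched — the positive half is
its known energy-class floor, the negative half concerns only (E₀, ν, T)-UNIFORM constants;
no crux claim.
-/

noncomputable section

namespace Summit.NavierStokesRegularity.NavierStokesRegularity.Theorems.L3TimeExponentPincerQuantJawEnergyLine

open MeasureTheory Set Filter Literature.Analysis.FluidPDE
open Summit.NavierStokesRegularity.NavierStokesRegularity.Theorems.L3TimeExponentPincerQuantJaw
open Summit.NavierStokesRegularity.NavierStokesRegularity.Theorems.L3TimeExponentPincerJawEnergyFloor
open Summit.NavierStokesRegularity.NavierStokesRegularity.Theorems.L3TimeExponentPincerRingPersistenceHolds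
open scoped ENNReal NNReal

/-! ### A. The energy-line bound with an explicit constant -/

/-- **`∫₀ᵀ ‖u‖₃⁴ ≤ E₀ · K² · E(u₀)/ν`** for every frame solution (`ν, T > 0`), where
`E₀ = energy0 u = ∫|u₀|²`, `E(u₀) = ½∫|u₀|²` and `K = SNormLESNormFDerivOfEqConst ℝ³ volume 2`. -/
theorem lpTime_three_four_le {ν T : ℝ} (hν : 0 < ν) (hT : 0 < T) {u : ℝ → E3 → E3}
    {pr : ℝ → E3 → ℝ} (hF : IsFrameSolution ν T u pr) :
    lpTime 3 4 T u ≤ energy0 u *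
      ((SNormLESNormFDerivOfEqConst (EuclideanSpace ℝ (Fin 3))
          (volume : Measure (EuclideanSpace ℝ (Fin 3))) 2 : ℝ≥0) : ℝ≥0∞) ^ 2 *
        ENNReal.ofReal (VectorCalculus.kineticEnergy (u 0) / ν) := by
  set K : ℝ≥0 := SNormLESNormFDerivOfEqConst (EuclideanSpace ℝ (Fin 3))
    (volume : Measure (EuclideanSpace ℝ (Fin 3))) 2 with hK
  have hcl := hF.classical
  have hLH := hF.lerayHopf
  -- the energy at every time
  have hE0eq : energy0 u = ENNReal.ofReal (2 * VectorCalculus.kineticEnergy (u 0)) := by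
    have := hLH.eEnergy_eq (t := 0) ⟨le_rfl, hT.le⟩
    rwa [eEnergy] at this
  have hen : ∀ t ∈ Ioo 0 T, ∫⁻ x, ‖u t x‖ₑ ^ 2 ≤ energy0 u := by
    intro t ht
    rw [hE0eq]
    exact hLH.lintegral_enorm_sq_le hν.le ⟨ht.1.le, ht.2.le⟩
  have hE0fin : energy0 u < ⊤ := energy0_lt_top_of_hasRapidSpatialDecay hF.decay
  -- the dissipation bound of the energy inequality
  obtain ⟨m, G, -, hG, hD⟩ := hLH.exists_measurable_dissipation hν hT
  -- a.e. slice bound `‖u(t)‖₃⁴ ≤ E₀ K² m(t)`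
  have hslice : ∀ᵐ t ∂(volume.restrict (Ioo 0 T)),
      eLpNorm (u t) 3 volume ^ (4 : ℝ) ≤ energy0 u * (K : ℝ≥0∞) ^ 2 * m t := by
    filter_upwards [hG, ae_restrict_mem measurableSet_Ioo] with t hGt ht
    obtain ⟨hwG, hmt, -⟩ := hGt
    have htc : t ∈ Ico 0 T := ⟨ht.1.le, ht.2⟩
    have hC1 : ContDiff ℝ 1 (u t) := (hcl.contDiff_velocity htc).of_le (by norm_cast)
    -- the classical gradient is a weak gradient, hence agrees a.e. with `G t`
    have hwF : HasWeakGradient (u t) (fderiv ℝ (u t)) := hasWeakGradient_fderiv_of_contDiff hC1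
    have heq : (fun x => fderiv ℝ (u t) x) =ᵐ[volume] G t := by
      have := Literature.Analysis.FunctionSpaces.HasWeakFDerivOn.unique_holds hwF hwG
      simpa [Measure.restrict_univ] using this
    have hdiss : ∫⁻ x, ENNReal.ofReal (frobeniusNormSq (fderiv ℝ (u t) x)) = m t := by
      rw [← hmt]
      refine lintegral_congr_ae ?_
      filter_upwards [heq] with x hx
      rw [hx]
    have h1 := eLpNorm_three_rpow_four_le hC1 ((hen t ht).trans_lt hE0fin)
    rw [hdiss] at h1
    calc eLpNorm (u t) 3 volume ^ (4 : ℝ)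
        ≤ (∫⁻ x, ‖u t x‖ₑ ^ 2) * ((K : ℝ≥0∞) ^ 2 * m t) := h1
      _ ≤ energy0 u * ((K : ℝ≥0∞) ^ 2 * m t) := mul_le_mul' (hen t ht) le_rfl
      _ = energy0 u * (K : ℝ≥0∞) ^ 2 * m t := (mul_assoc _ _ _).symm
  have hcst : energy0 u * (K : ℝ≥0∞) ^ 2 ≠ ⊤ :=
    ENNReal.mul_ne_top hE0fin.ne (ENNReal.pow_ne_top ENNReal.coe_ne_top)
  calc lpTime 3 4 T u = ∫⁻ t in Ioo 0 T, eLpNorm (u t) 3 volume ^ (4 : ℝ) := rfl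
    _ ≤ ∫⁻ t in Ioo 0 T, energy0 u * (K : ℝ≥0∞) ^ 2 * m t := lintegral_mono_ae hslice
    _ = energy0 u * (K : ℝ≥0∞) ^ 2 * ∫⁻ t in Ioo 0 T, m t := lintegral_const_mul' _ _ hcst
    _ ≤ energy0 u * (K : ℝ≥0∞) ^ 2 * ENNReal.ofReal (VectorCalculus.kineticEnergy (u 0) / ν) :=
        mul_le_mul' le_rfl hD

/-- **`QuantJaw 4`: the uniform quantitative jaw ON the energy line** — for every `ν, T, E` one
constant (`E · K² · E/(2ν)`) bounds `∫₀ᵀ‖u‖₃⁴` for all frame solutions with `∫|u₀|² ≤ E`. -/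
theorem quantJaw_four : QuantJaw 4 := by
  intro ν T E hν hT hE
  set K : ℝ≥0 := SNormLESNormFDerivOfEqConst (EuclideanSpace ℝ (Fin 3))
    (volume : Measure (EuclideanSpace ℝ (Fin 3))) 2 with hK
  set B : ℝ≥0∞ := ENNReal.ofReal E * (K : ℝ≥0∞) ^ 2 * ENNReal.ofReal (E / (2 * ν)) with hB
  have hBt : B ≠ ⊤ := ENNReal.mul_ne_top
    (ENNReal.mul_ne_top ENNReal.ofReal_ne_top (ENNReal.pow_ne_top ENNReal.coe_ne_top))
    ENNReal.ofReal_ne_top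
  refine ⟨B.toNNReal, fun u pr hF hEu => ?_⟩
  rw [ENNReal.coe_toNNReal hBt]
  -- `E(u₀) ≤ E/2`
  have hE0eq : energy0 u = ENNReal.ofReal (2 * VectorCalculus.kineticEnergy (u 0)) := by
    have := hF.lerayHopf.eEnergy_eq (t := 0) ⟨le_rfl, hT.le⟩
    rwa [eEnergy] at this
  have hkin : VectorCalculus.kineticEnergy (u 0) / ν ≤ E / (2 * ν) := by
    have h2 : 2 * VectorCalculus.kineticEnergy (u 0) ≤ E := by
      rw [hE0eq] at hEu
      exact (ENNReal.ofReal_le_ofReal_iff hE).1 hEu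
    rw [div_le_div_iff₀ hν (by positivity)]
    nlinarith
  calc lpTime 3 4 T u
      ≤ energy0 u * (K : ℝ≥0∞) ^ 2 * ENNReal.ofReal (VectorCalculus.kineticEnergy (u 0) / ν) :=
        lpTime_three_four_le hν hT hF
    _ ≤ ENNReal.ofReal E * (K : ℝ≥0∞) ^ 2 * ENNReal.ofReal (E / (2 * ν)) := by
        gcongr
    _ = B := rfl

/-! ### B. Below the energy line, and the dichotomy -/

/-- `x^q ≤ 1 + x⁴` in `ℝ≥0∞` for `0 ≤ q ≤ 4`. -/
theorem rpow_le_one_add_rpow_four {x : ℝ≥0∞} {q : ℝ} (hq0 : 0 ≤ q) (hq4 : q ≤ 4) :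
    x ^ q ≤ 1 + x ^ (4 : ℝ) := by
  rcases le_total x 1 with h | h
  · exact (ENNReal.rpow_le_one h hq0).trans le_self_add
  · exact (ENNReal.rpow_le_rpow_of_exponent_le h hq4).trans le_add_self

/-- **`QuantJaw q` for every `0 ≤ q ≤ 4`** (`∫₀ᵀ‖u‖₃^q ≤ T + ∫₀ᵀ‖u‖₃⁴`). -/
theorem quantJaw_of_le_four {q : ℝ} (hq0 : 0 ≤ q) (hq4 : q ≤ 4) : QuantJaw q := by
  intro ν T E hν hT hE
  obtain ⟨B, hB⟩ := quantJaw_four ν T E hν hT hE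
  refine ⟨(ENNReal.ofReal T).toNNReal + B, fun u pr hF hEu => ?_⟩
  have h4 := hB u pr hF hEu
  calc lpTime 3 q T u = ∫⁻ t in Ioo 0 T, eLpNorm (u t) 3 volume ^ q := rfl
    _ ≤ ∫⁻ t in Ioo 0 T, ((fun _ => (1 : ℝ≥0∞)) t + eLpNorm (u t) 3 volume ^ (4 : ℝ)) :=
        lintegral_mono fun t => rpow_le_one_add_rpow_four hq0 hq4
    _ = (∫⁻ _ in Ioo 0 T, (1 : ℝ≥0∞)) + ∫⁻ t in Ioo 0 T, eLpNorm (u t) 3 volume ^ (4 : ℝ) :=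
        lintegral_add_left measurable_const _
    _ ≤ ENNReal.ofReal T + (B : ℝ≥0∞) := by
        gcongr
        · rw [setLIntegral_const, Real.volume_Ioo, sub_zero, one_mul]
        · exact h4
    _ = (((ENNReal.ofReal T).toNNReal + B : ℝ≥0) : ℝ≥0∞) := by
        rw [ENNReal.coe_add, ENNReal.coe_toNNReal ENNReal.ofReal_ne_top]

/-- **The dichotomy: the uniform quantitative jaw holds exactly on and below the energy line.**
For every `q ≥ 0`: `QuantJaw q ↔ q ≤ 4` (`⇐`: energy × dissipation, this file; `⇒`: the viscous
rings, `not_quantJaw`). -/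
theorem quantJaw_iff {q : ℝ} (hq0 : 0 ≤ q) : QuantJaw q ↔ q ≤ 4 :=
  ⟨fun h => le_of_not_gt fun h4 => not_quantJaw h4 h, quantJaw_of_le_four hq0⟩

/--
info: 'Summit.NavierStokesRegularity.NavierStokesRegularity.Theorems.L3TimeExponentPincerQuantJawEnergyLine.quantJaw_iff' depends on axioms: [propext,
 Classical.choice,
 Quot.sound]
-/
#guard_msgs in
#print axioms quantJaw_iff

end Summit.NavierStokesRegularity.NavierStokesRegularity.Theorems.L3TimeExponentPincerQuantJawEnergyLine

end
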